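import Summits.QuantumFields.YangMills.Theorems.LuscherReductionTwistedTraceScalingBOStiffCoreMass
import Summits.QuantumFields.YangMills.Theorems.LuscherReductionTwistedTraceScalingBOStiffCoreForm
import Summits.QuantumFields.YangMills.Theorems.LuscherReductionTwistedTraceScalingBOProjection
import HarnessLib

/-!
# (B-ST) (W1-10c) `…BOStiffSmearKernel`: moving the based average between kernel and test function, and the tube disintegration of the smeared form — two exact identities for (A)
# (lane A of S-BASE, crux `TwistedTraceScaling` stmt-QuantumFields-20203, C4-CORE, the (B-ST) pen; g22 HANDOFF-g22 note 5 route for (A) = spec_S3, steps (R2), (R1)-identity)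

* ★ `integral_kernel_basedAvg_eq_basedKernel` — for bounded measurable `G`: `∫ K_β(U,V)·(P₀G)(V) dμ(V) = ∫ (∫ K_β(U,V^{bE h}) dh)·G(V) dμ(V)`, `P₀G(V) = ∫ G(V^{bE h}) dh`
  (✓`integral_kernel_comp_based` + Fubini + ✓`basedKernel_symm`);
* ★ `integral_basedKernel_boFun_eq_tube` — for a bounded measurable slow window `φ` and fibre profile `Ω`:
  `∫ (∫ K_β(U,V^{bE h}) dh)·boFun φ Ω (V) dμ(V) = ∫_u φ(u) ∫_y (∫ K_β(U,(oT u y)^{bE h}) dh)·Ω(ŷ) dπ(y) dσ³(u)` (✓`integral_configMeasure_orthoTube_prod`, ✓`boFun_orthoTube`).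
Together: `⟨K_β(oT 1 x, ·), P₀(boFun φ Ω_c)⟩_μ = ∫_u φ(u)·[∫_y K̂(oT 1 x, oT u y) cΘ(y) dπ]dσ³`, the smeared form of `MΘ(x)` (then ✓`basedKernel_product_near` gives `≈ Z_φ·MΘ(x)`).
HONEST FRAMING: bookkeeping for a stub of a child of the CONDITIONAL route R2b1; (Q±) OPEN; (B-ST), C4-CORE OPEN; not infinite volume, not a gap, not Clay.
-/

set_option autoImplicit false

noncomputable section

open MeasureTheory Filter Topology Real
open scoped BigOperators
open Literature.MathematicalPhysics.QuantumFieldTheory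
open Literature.MathematicalPhysics.QuantumLattice

namespace Summit.QuantumFields.YangMills.Theorems.FemtoTransferGap.TwoLattice.ConstTube

open Summit.QuantumFields.YangMills.Theorems.FemtoTransferGap
open Summit.QuantumFields.YangMills.Theorems.FemtoTransferGap.TwoLattice
open Summit.QuantumFields.YangMills.Theorems.FemtoTransferGap.TwoLattice.Avg
open Summit.QuantumFields.YangMills.Theorems.FemtoTransferGap.TwoLattice.Stiff (LinkSpace)

variable {L : ℕ} [NeZero L]

/-! ## §1 Based average: from the test function to the kernel -/

/-- ★ **`∫ K(U,V)·(P₀G)(V) dV = ∫ K̂(U,V)·G(V) dV`** with `P₀G(V) = ∫ G(V^{bE h}) dh`, `K̂(U,V) = ∫ K(U,V^{bE h}) dh`, for bounded measurable `G`. [cite: SeilerLNP1982, §3] -/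
theorem integral_kernel_basedAvg_eq_basedKernel (β : ℝ) {G : GaugeConfig 3 L SU2 → ℝ} (hG : Measurable G) {CG : ℝ} (hCG : ∀ V, |G V| ≤ CG) (U : GaugeConfig 3 L SU2) :
    ∫ V, transferKernel su2Rep β U V * (∫ h, G (gaugeTransform (basedExt L h) V) ∂basedMeasure L) ∂configMeasure SU2 L =
      ∫ V, (∫ h, transferKernel su2Rep β U (gaugeTransform (basedExt L h) V) ∂basedMeasure L) * G V ∂configMeasure SU2 L := by
  haveI : IsProbabilityMeasure (basedMeasure L) := by unfold basedMeasure; infer_instance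
  obtain ⟨M, hM⟩ := exists_transferKernel_le su2Rep continuous_su2Rep β (L := L)
  have hM0 : 0 ≤ M := (transferKernel_pos su2Rep β (1 : GaugeConfig 3 L SU2) 1).le.trans (hM 1 1)
  have hCG0 : 0 ≤ CG := (abs_nonneg _).trans (hCG 1)
  -- joint measurability of `(V,h) ↦ K(U,V)·G(V^h)` and `(V,h) ↦ K(U,V^h)·G(V)`
  have hKm : Measurable fun V : GaugeConfig 3 L SU2 => transferKernel su2Rep β U V := measurable_transferKernel_left β _
  have hact : Measurable fun p : GaugeConfig 3 L SU2 × (NzSite L → SU2) => gaugeTransform (basedExt L p.2) p.1 := by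
    have h := (measurable_gaugeAction (L := L)).comp (measurable_fst.prodMk ((measurable_basedExt L).comp measurable_snd))
    simpa only [Function.comp_def] using h
  have hF1 : Measurable fun p : GaugeConfig 3 L SU2 × (NzSite L → SU2) => transferKernel su2Rep β U p.1 * G (gaugeTransform (basedExt L p.2) p.1) :=
    (hKm.comp measurable_fst).mul (hG.comp hact)
  have hF2 : Measurable fun p : GaugeConfig 3 L SU2 × (NzSite L → SU2) => transferKernel su2Rep β U (gaugeTransform (basedExt L p.2) p.1) * G p.1 :=
    (hKm.comp hact).mul (hG.comp measurable_fst)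
  have hb1 : ∀ p : GaugeConfig 3 L SU2 × (NzSite L → SU2), |transferKernel su2Rep β U p.1 * G (gaugeTransform (basedExt L p.2) p.1)| ≤ M * CG := fun p => by
    rw [abs_mul, abs_of_pos (transferKernel_pos _ _ _ _)]; exact mul_le_mul (hM _ _) (hCG _) (abs_nonneg _) hM0
  have hb2 : ∀ p : GaugeConfig 3 L SU2 × (NzSite L → SU2), |transferKernel su2Rep β U (gaugeTransform (basedExt L p.2) p.1) * G p.1| ≤ M * CG := fun p => by
    rw [abs_mul, abs_of_pos (transferKernel_pos _ _ _ _)]; exact mul_le_mul (hM _ _) (hCG _) (abs_nonneg _) hM0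
  have hi1 : Integrable (fun p : GaugeConfig 3 L SU2 × (NzSite L → SU2) => transferKernel su2Rep β U p.1 * G (gaugeTransform (basedExt L p.2) p.1))
      ((configMeasure SU2 L).prod (basedMeasure L)) := integrable_of_measurable_abs_le _ hF1 hb1
  have hi2 : Integrable (fun p : GaugeConfig 3 L SU2 × (NzSite L → SU2) => transferKernel su2Rep β U (gaugeTransform (basedExt L p.2) p.1) * G p.1)
      ((configMeasure SU2 L).prod (basedMeasure L)) := integrable_of_measurable_abs_le _ hF2 hb2
  -- LHS = ∫_V ∫_h K(U,V) G(V^h) = ∫_h ∫_V K(U,V) G(V^h)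
  have e1 : ∫ V, transferKernel su2Rep β U V * (∫ h, G (gaugeTransform (basedExt L h) V) ∂basedMeasure L) ∂configMeasure SU2 L =
      ∫ V, ∫ h, transferKernel su2Rep β U V * G (gaugeTransform (basedExt L h) V) ∂basedMeasure L ∂configMeasure SU2 L := by
    refine integral_congr_ae (ae_of_all _ fun V => ?_); exact (integral_const_mul _ _).symm
  have e2 : ∫ V, (∫ h, transferKernel su2Rep β U (gaugeTransform (basedExt L h) V) ∂basedMeasure L) * G V ∂configMeasure SU2 L =
      ∫ V, ∫ h, transferKernel su2Rep β U (gaugeTransform (basedExt L h) V) * G V ∂basedMeasure L ∂configMeasure SU2 L := by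
    refine integral_congr_ae (ae_of_all _ fun V => ?_); exact (integral_mul_const _ _).symm
  rw [e1, e2, integral_integral_swap hi1]
  have e3 : ∫ V, ∫ h, transferKernel su2Rep β U (gaugeTransform (basedExt L h) V) * G V ∂basedMeasure L ∂configMeasure SU2 L =
      ∫ h, ∫ V, transferKernel su2Rep β U (gaugeTransform (basedExt L h) V) * G V ∂configMeasure SU2 L ∂basedMeasure L := integral_integral_swap hi2
  rw [e3, ← integral_inv_eq_self (fun h : NzSite L → SU2 => ∫ V, transferKernel su2Rep β U (gaugeTransform (basedExt L h) V) * G V ∂configMeasure SU2 L) (basedMeasure L)]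
  refine integral_congr_ae (ae_of_all _ fun h => ?_)
  show ∫ V, transferKernel su2Rep β U V * G (gaugeTransform (basedExt L h) V) ∂configMeasure SU2 L =
    ∫ V, transferKernel su2Rep β U (gaugeTransform (basedExt L h⁻¹) V) * G V ∂configMeasure SU2 L
  rw [integral_kernel_comp_based β hG h U]
  refine integral_congr_ae (ae_of_all _ fun V => ?_)
  show transferKernel su2Rep β V (gaugeTransform (basedExt L h) U) * G V = transferKernel su2Rep β U (gaugeTransform (basedExt L h⁻¹) V) * G V
  rw [basedExt_inv, transferKernel_inv_right]


/-! ## §2 Tube disintegration of the smeared form -/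

set_option maxHeartbeats 800000 in
-- long integrands.
/-- ★ **`∫ K̂(U,V)·boFun φ Ω (V) dμ(V) = ∫_u ∫_y φ(u)·K̂(U, oT u y)·Ω(ŷ) dπ(y) dσ³(u)`** for bounded measurable `φ`, `Ω` (`K̂` the based kernel). [folklore] -/
theorem integral_basedKernel_boFun_eq_tube (β : ℝ) {φ : GaugeConfig 3 1 SU2 → ℝ} (hφ : Measurable φ) {Cφ : ℝ} (hCφ : ∀ u, |φ u| ≤ Cφ)
    {Ω : LinkSpace L → ℝ} (hΩm : Measurable Ω) {CΩ : ℝ} (hCΩ : ∀ x, |Ω x| ≤ CΩ) (U : GaugeConfig 3 L SU2) :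
    ∫ V, (∫ h, transferKernel su2Rep β U (gaugeTransform (basedExt L h) V) ∂basedMeasure L) * boFun L φ Ω V ∂configMeasure SU2 L =
      ∫ u, ∫ y, φ u * ((∫ h, transferKernel su2Rep β U (gaugeTransform (basedExt L h) (orthoTube L u y)) ∂basedMeasure L) * Ω (linkEmbed L y))
        ∂orthoTransverse L ∂configMeasure SU2 1 := by
  haveI := isFiniteMeasure_orthoTransverse L
  obtain ⟨M, hM⟩ := basedKernel_bounds (L := L) β
  have hKm : Measurable fun V : GaugeConfig 3 L SU2 => ∫ h, transferKernel su2Rep β U (gaugeTransform (basedExt L h) V) ∂basedMeasure L := by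
    have h := (measurable_basedKernel_uncurry (L := L) β).comp (measurable_const.prodMk measurable_id : Measurable fun V : GaugeConfig 3 L SU2 => (U, V))
    simpa only [Function.comp_def] using h
  have hKb : ∀ V, |∫ h, transferKernel su2Rep β U (gaugeTransform (basedExt L h) V) ∂basedMeasure L| ≤ M := fun V => by
    rw [abs_of_nonneg (hM U V).1]; exact (hM U V).2
  have hM0 : 0 ≤ M := (abs_nonneg _).trans (hKb U)
  have hCφ0 : 0 ≤ Cφ := (abs_nonneg _).trans (hCφ 1)
  have hFm : Measurable fun V => (∫ h, transferKernel su2Rep β U (gaugeTransform (basedExt L h) V) ∂basedMeasure L) * boFun L φ Ω V := hKm.mul (measurable_boFun L hφ hΩm)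
  have hFb : ∃ C : ℝ, ∀ V, |(∫ h, transferKernel su2Rep β U (gaugeTransform (basedExt L h) V) ∂basedMeasure L) * boFun L φ Ω V| ≤ C :=
    ⟨M * (Cφ * CΩ), fun V => by rw [abs_mul]; exact mul_le_mul (hKb V) (abs_boFun_le L hCφ hCΩ V) (abs_nonneg _) hM0⟩
  rw [integral_configMeasure_orthoTube_prod hFm hFb (fun V hV => by rw [boFun_eq_zero_of_not_mem L φ Ω hV, mul_zero])]
  -- pointwise on the tube (a.e.: the fibre point lies in the cap)
  have hnull : ((configMeasure SU2 1).prod (orthoTransverse L)) (Prod.snd ⁻¹' (capBalancedSet L)ᶜ) = 0 := by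
    have e : (Prod.snd ⁻¹' (capBalancedSet L)ᶜ : Set (GaugeConfig 3 1 SU2 × (Edge 3 L → Fin 3 → ℝ))) = Set.univ ×ˢ (capBalancedSet L)ᶜ := by
      ext p; simp
    rw [e, Measure.prod_prod, orthoTransverse_compl_capBalancedSet, mul_zero]
  have hae : ∀ᵐ p ∂(configMeasure SU2 1).prod (orthoTransverse L), p.2 ∈ capBalancedSet L := by
    rw [ae_iff]; exact measure_mono_null (fun p hp => hp) hnull
  have hKm2 : Measurable fun p : GaugeConfig 3 1 SU2 × (Edge 3 L → Fin 3 → ℝ) =>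
      ∫ h, transferKernel su2Rep β U (gaugeTransform (basedExt L h) (orthoTube L p.1 p.2)) ∂basedMeasure L := by
    have h := hKm.comp (measurable_orthoTube (L := L)); simpa only [Function.comp_def] using h
  have hGm : Measurable fun p : GaugeConfig 3 1 SU2 × (Edge 3 L → Fin 3 → ℝ) =>
      φ p.1 * ((∫ h, transferKernel su2Rep β U (gaugeTransform (basedExt L h) (orthoTube L p.1 p.2)) ∂basedMeasure L) * Ω (linkEmbed L p.2)) :=
    (hφ.comp measurable_fst).mul (hKm2.mul (hΩm.comp ((measurable_linkEmbed (L := L)).comp measurable_snd)))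
  have hGb : ∀ p : GaugeConfig 3 1 SU2 × (Edge 3 L → Fin 3 → ℝ),
      |φ p.1 * ((∫ h, transferKernel su2Rep β U (gaugeTransform (basedExt L h) (orthoTube L p.1 p.2)) ∂basedMeasure L) * Ω (linkEmbed L p.2))| ≤ Cφ * (M * CΩ) := fun p => by
    rw [abs_mul, abs_mul]; exact mul_le_mul (hCφ _) (mul_le_mul (hKb _) (hCΩ _) (abs_nonneg _) hM0) (by positivity) hCφ0
  rw [iter_integral_eq_prod (ν := configMeasure SU2 1) (μ := orthoTransverse L) hGm hGb]
  refine integral_congr_ae (hae.mono fun p hp => ?_)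
  show (∫ h, transferKernel su2Rep β U (gaugeTransform (basedExt L h) (orthoTube L p.1 p.2)) ∂basedMeasure L) * boFun L φ Ω (orthoTube L p.1 p.2) =
    φ p.1 * ((∫ h, transferKernel su2Rep β U (gaugeTransform (basedExt L h) (orthoTube L p.1 p.2)) ∂basedMeasure L) * Ω (linkEmbed L p.2))
  rw [boFun_orthoTube L φ Ω p.1 hp]; ring

end Summit.QuantumFields.YangMills.Theorems.FemtoTransferGap.TwoLattice.ConstTube

end
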